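import Summits.CriticalPhenomena.PercolationContinuityZ3.Theorems.PercNearOneGluingNoHeavyLowerTailSahiGridPatternPairCert
import Summits.CriticalPhenomena.PercolationContinuityZ3.Theorems.PercNearOneGluingNoHeavyLowerTailSahiGridPatternDiagCert
import Summits.CriticalPhenomena.PercolationContinuityZ3.Theorems.PercNearOneGluingNoHeavyLowerTailSahiGridPatternKleitman

/-!
# `NoHeavyLowerTail` (crux stmt-CriticalPhenomena-4575), Sahi programme P1: **BLOCK PRODUCTS OF A FIRST SLOT — condition (T) of a diagonal
# certificate MULTIPLIES against the trivial vector of ANY up-set** (`S × V`, `S ⊆ [3]^n` arbitrary up-set, `V ⊆ [3]^k` with (T) for `d`):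
# `d'(ξ,q) = 2^n·1_S(ξ)·d(q)` satisfies (T) for `S × V ⊆ [3]^{n+k}`, every `n, k`

Support file (Sahi cell, seat `prim-sahi-p1`, generation 29; `--supports stmt-CriticalPhenomena-4575`).  Pure proofs, no definitions, no `sorry`,
standard axioms.  Vocabulary of `…SahiGridPattern{,CellForm,SliceForm,DiagCert,PairCert}` (`Pd`, `glue`, `freeOf`, `cellOf`, `fibre`, `sect`, `ind`,
`TotDist`, `nuCount`, `lamU`).

THE MATHEMATICS.  A DIAGONAL CERTIFICATE of an up-set `U ⊆ [3]^k` (`…SahiGridPatternDiagCert`) is `d ≥ 0` with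
(T) `Σ_{q∈W} d(q) ≤ Σ_{q∈W} λ_U(q)` for every up-set `W` and (N) `Θ_U(P×Q) ≤ d(P∩Q)` for all up-sets `P, Q`; it makes `U × [3]^m` a good first slot of the
pattern functional in every dimension.  The generation-28 certificate calculus propagates certificates along ONE axis (cylinder, the four literal
steps).  This file starts the BLOCK version: the first slot is a block product `A = S × V = {x : freeOf x ∈ S ∧ cellOf x ∈ V} ⊆ [3]^{n+k}` of two
up-sets on complementary blocks of axes, and the candidate certificate is `d'(x) = 2^n · 1_S(freeOf x) · d(cellOf x)` (the trivial vector `2^n·1_S` of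
`S` tensor a certificate `d` of `V`).
* `ind_glue_blockAnd`, **`nuCount_blockAnd`** (`ν_{S×V}(glue ξ q) = ν_S(ξ)·ν_V(q)`), `lamU_blockAnd` — the slice data of a block product factorise.
* **`sum_nuCount_mul_ind_glue_le`** (weighted coefficientwise Harris in the free block): for up-sets `S ⊆ [3]^n`, `W ⊆ [3]^{n+k}` and every cell `q`,
  `Σ_ξ ν_S(ξ)·1_W(glue ξ q) ≤ 2^n·Σ_ξ 1_S(ξ)·1_W(glue ξ q)` (Harris `sum_ind_totDist_le` against the fibre `W_q`, an up-set).
* **THEOREM `diagCert_blockAnd_T` (every `n, k`, EVERY up-set `S`).**  If `d` satisfies (T) for `V`, then `d'` satisfies (T) for `S × V`: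
  `Σ_{x∈W} d'(x) ≤ Σ_{x∈W} λ_{S×V}(x)` for every up-set `W ⊆ [3]^{n+k}`.  PROOF (identity + two inequalities):
  `λ_{S×V}(W) − d'(W) = 2^n Σ_{ξ∈S} [λ_V(W^ξ) − d(W^ξ)] + Σ_q ν_V(q)·[2^n Σ_ξ 1_S(ξ)1_W(glue ξ q) − Σ_ξ ν_S(ξ)1_W(glue ξ q)]`,
  the first bracket `≥ 0` by (T) on the sections `W^ξ` (up-sets), the second by the weighted Harris lemma.
So condition (T) costs nothing in the block-AND step, for ANY up-set `S`; the companion condition (N) for `d'` does NOT hold for every `S` — by exact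
computation (seat memo FROM-prim-sahi-p1-gen29, §2) it holds, for all certified `V` tested, exactly when the trivial vector `2^n·1_S` satisfies (N) for `S`
itself (`S` "Θ-Harris": all principal up-sets, all literals, and e.g. `↑{12,21} ⊆ [3]²`; 10/19 up-sets of `[3]²`, 57/979 of `[3]³`), where it reduces to a
finite ROUTING certificate in the `S`-block (found by LP for every Θ-Harris `S ⊆ [3]^j`, `j ≤ 2`).  With `n = 1`, `S = {t ≥ 1}` resp. `{t = 2}` this (T)
statement is the (T') half of `…DiagCertLiteralAnd` resp. of the literal step `T2`; with `S = ⊤` it is the (T) half of the cylinder lift.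
Nothing here asserts `PatternPos d` for `d ≥ 4` or condition (N) for any block product. [this work]
-/

namespace Summit.CriticalPhenomena.PercolationContinuityZ3.Theorems.SahiGridPattern

open Finset SahiGrid3
open scoped BigOperators

variable {n k : ℕ} {S : Finset (Pd n)} {V : Finset (Pd k)} {A : Finset (Pd (n + k))}

/-! ### Slice data of a block product `S × V` -/

/-- Indicator of the block product: `1_A(glue ξ z) = 1_S(ξ)·1_V(z)`. [this work] -/
theorem ind_glue_blockAnd (hA : ∀ ξ z, glue ξ z ∈ A ↔ (ξ ∈ S ∧ z ∈ V)) (ξ : Pd n) (z : Pd k) :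
    ind A (glue ξ z) = ind S ξ * ind V z := by
  unfold ind
  simp only [hA]
  by_cases h1 : ξ ∈ S <;> by_cases h2 : z ∈ V <;> simp [h1, h2]

/-- Indicator of the block product at an arbitrary point. [this work] -/
theorem ind_blockAnd (hA : ∀ ξ z, glue ξ z ∈ A ↔ (ξ ∈ S ∧ z ∈ V)) (x : Pd (n + k)) :
    ind A x = ind S (freeOf x) * ind V (cellOf x) := by
  rw [← ind_glue_blockAnd hA, glue_freeOf_cellOf]

/-- **`ν` of a block product factorises**: `ν_{S×V}(glue ξ q) = ν_S(ξ) · ν_V(q)`. [this work] -/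
theorem nuCount_blockAnd (hA : ∀ ξ z, glue ξ z ∈ A ↔ (ξ ∈ S ∧ z ∈ V)) (ξ : Pd n) (q : Pd k) :
    (nuCount A (glue ξ q) : ℤ) = (nuCount S ξ : ℤ) * (nuCount V q : ℤ) := by
  rw [nuCount_eq_sum_ind, nuCount_eq_sum_ind, nuCount_eq_sum_ind, sum_glue, Finset.sum_mul]
  refine Finset.sum_congr rfl fun η _ => ?_
  rw [Finset.mul_sum]
  refine Finset.sum_congr rfl fun r _ => ?_
  rw [ind_glue_blockAnd hA]
  by_cases h : TotDist (glue η r) (glue ξ q) = true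
  · obtain ⟨h1, h2⟩ := (totDist_glue η ξ r q).1 h
    rw [if_pos h, if_pos h1, if_pos h2]; ring
  · rw [if_neg h]
    have hn : ¬ (TotDist η ξ = true ∧ TotDist r q = true) := fun hh => h ((totDist_glue η ξ r q).2 hh)
    by_cases h1 : TotDist η ξ = true
    · have h2 : ¬ TotDist r q = true := fun h2 => hn ⟨h1, h2⟩
      rw [if_pos h1, if_neg h2]; ring
    · rw [if_neg h1]; ring

/-- **`λ` of a block product**: `λ_{S×V}(glue ξ q) = 2·2^{n+k}·1_S(ξ)1_V(q) − ν_S(ξ)ν_V(q)`. [this work] -/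
theorem lamU_blockAnd (hA : ∀ ξ z, glue ξ z ∈ A ↔ (ξ ∈ S ∧ z ∈ V)) (ξ : Pd n) (q : Pd k) :
    lamU A (glue ξ q) = 2 * (2:ℤ) ^ (n + k) * (ind S ξ * ind V q) - (nuCount S ξ : ℤ) * (nuCount V q : ℤ) := by
  unfold lamU
  rw [ind_glue_blockAnd hA, nuCount_blockAnd hA]

/-- **`Θ` of a block product**: for glued points, `Θ_{S×V}(glue ξ q, glue η r) = [ξ δ̸ η][q δ̸ r]·(1_S(ξ)1_V(q) + 1_S(η)1_V(r) − 1_S(ζ)1_V(m))`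
with `ζ, m` the third points in the two blocks. [this work] -/
theorem thetaVal_blockAnd (hA : ∀ ξ z, glue ξ z ∈ A ↔ (ξ ∈ S ∧ z ∈ V)) (ξ η : Pd n) (q r : Pd k) :
    thetaVal A (glue ξ q) (glue η r) =
      if (TotDist ξ η = true ∧ TotDist q r = true) then
        ind S ξ * ind V q + ind S η * ind V r - ind S (thirdPt ξ η) * ind V (thirdPt q r) else 0 := by
  unfold thetaVal
  rw [thirdPt_glue, ind_glue_blockAnd hA, ind_glue_blockAnd hA, ind_glue_blockAnd hA]
  by_cases h : TotDist (glue ξ q) (glue η r) = true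
  · rw [if_pos h, if_pos ((totDist_glue ξ η q r).1 h)]
  · have hn : ¬ (TotDist ξ η = true ∧ TotDist q r = true) := fun hh => h ((totDist_glue ξ η q r).2 hh)
    rw [if_neg h, if_neg hn]

/-! ### Weighted coefficientwise Harris in the free block -/

/-- **Weighted Harris against a fibre** (every `n, k`): for up-sets `S ⊆ [3]^n` and `W ⊆ [3]^{n+k}` and every cell `q`,
`Σ_ξ ν_S(ξ)·1_W(glue ξ q) ≤ 2^n · Σ_ξ 1_S(ξ)·1_W(glue ξ q)` — the number of totally distinct pairs `S × W_q` is at most `2^n·#(S ∩ W_q)` for the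
fibre `W_q = {ξ : glue ξ q ∈ W}`, an up-set. [this work] -/
theorem sum_nuCount_mul_ind_glue_le (hS : IsUpperSet (S : Set (Pd n))) {W : Finset (Pd (n + k))}
    (hW : IsUpperSet (W : Set (Pd (n + k)))) (q : Pd k) :
    (∑ ξ : Pd n, (nuCount S ξ : ℤ) * ind W (glue ξ q)) ≤ 2 ^ n * ∑ ξ : Pd n, ind S ξ * ind W (glue ξ q) := by
  have h := sum_ind_totDist_le n S (fibre W q) hS (isUpperSet_fibre hW q)
  have hl : (∑ ξ : Pd n, (nuCount S ξ : ℤ) * ind W (glue ξ q)) =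
      ∑ p : Pd n, ∑ ξ : Pd n, ind S p * ind (fibre W q) ξ * (if TotDist p ξ = true then (1:ℤ) else 0) := by
    rw [Finset.sum_comm]
    refine Finset.sum_congr rfl fun ξ _ => ?_
    rw [nuCount_eq_sum_ind, Finset.sum_mul]
    refine Finset.sum_congr rfl fun p _ => ?_
    rw [ind_fibre]; ring
  have hr : (∑ ξ : Pd n, ind S ξ * ind W (glue ξ q)) = ∑ p : Pd n, ind S p * ind (fibre W q) p := by
    refine Finset.sum_congr rfl fun ξ _ => ?_
    rw [ind_fibre]
  rw [hl, hr]
  exact h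

/-! ### Condition (T) multiplies -/

/-- A sum over an up-set `W ⊆ [3]^{n+k}` by sections: `Σ_{x∈W} F(x) = Σ_ξ Σ_q 1_W(glue ξ q)·F(glue ξ q)`. [this work] -/
theorem sum_mem_eq_sum_glue (W : Finset (Pd (n + k))) (F : Pd (n + k) → ℤ) :
    (∑ x ∈ W, F x) = ∑ ξ : Pd n, ∑ q : Pd k, ind W (glue ξ q) * F (glue ξ q) := by
  rw [sum_mem_eq_sum_ind_mul, sum_glue]

/-- The section sum `Σ_q 1_W(glue ξ q)·G(q) = Σ_{q ∈ W^ξ} G(q)`. [this work] -/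
theorem sum_ind_glue_mul_eq_sum_sect (W : Finset (Pd (n + k))) (ξ : Pd n) (G : Pd k → ℤ) :
    (∑ q : Pd k, ind W (glue ξ q) * G q) = ∑ q ∈ sect W ξ, G q := by
  rw [sum_mem_eq_sum_ind_mul (sect W ξ) G]
  refine Finset.sum_congr rfl fun q _ => ?_
  rw [ind_sect]

/-- **THEOREM (condition (T) multiplies against the trivial vector of any up-set; every `n, k`).**  Let `S ⊆ [3]^n` be an up-set, `V ⊆ [3]^k`,
`A = S × V` (`glue ξ z ∈ A ↔ ξ ∈ S ∧ z ∈ V`), and let `d` satisfy (T) for `V`.  Then `d'(x) = 2^n·1_S(freeOf x)·d(cellOf x)` satisfies (T) for `A`: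
`Σ_{x∈W} d'(x) ≤ Σ_{x∈W} λ_A(x)` for every up-set `W ⊆ [3]^{n+k}`. [this work] -/
theorem diagCert_blockAnd_T (hA : ∀ ξ z, glue ξ z ∈ A ↔ (ξ ∈ S ∧ z ∈ V)) (hS : IsUpperSet (S : Set (Pd n))) (d : Pd k → ℤ)
    (hT : ∀ W : Finset (Pd k), IsUpperSet (W : Set (Pd k)) → (∑ q ∈ W, d q) ≤ ∑ q ∈ W, lamU V q)
    {W : Finset (Pd (n + k))} (hW : IsUpperSet (W : Set (Pd (n + k)))) :
    (∑ x ∈ W, (2:ℤ) ^ n * ind S (freeOf x) * d (cellOf x)) ≤ ∑ x ∈ W, lamU A x := by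
  -- both sides by sections
  rw [sum_mem_eq_sum_glue, sum_mem_eq_sum_glue]
  simp only [freeOf_glue, cellOf_glue, lamU_blockAnd hA]
  -- (T) on each section `W^ξ`, weighted by `2^n·1_S(ξ) ≥ 0`
  have hsec : ∀ ξ : Pd n, (∑ q : Pd k, ind W (glue ξ q) * ((2:ℤ) ^ n * ind S ξ * d q)) ≤
      (2:ℤ) ^ n * ind S ξ * ∑ q : Pd k, ind W (glue ξ q) * lamU V q := by
    intro ξ
    have e1 : (∑ q : Pd k, ind W (glue ξ q) * ((2:ℤ) ^ n * ind S ξ * d q)) = (2:ℤ) ^ n * ind S ξ * ∑ q : Pd k, ind W (glue ξ q) * d q := by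
      rw [Finset.mul_sum]; refine Finset.sum_congr rfl fun q _ => ?_; ring
    rw [e1, sum_ind_glue_mul_eq_sum_sect, sum_ind_glue_mul_eq_sum_sect]
    have hc : (0:ℤ) ≤ (2:ℤ) ^ n * ind S ξ := mul_nonneg (pow_nonneg (by norm_num) n) (ind_nonneg' S ξ)
    exact mul_le_mul_of_nonneg_left (hT (sect W ξ) (isUpperSet_sect hW ξ)) hc
  -- the weighted Harris slack, cell by cell
  have hhar : ∀ q : Pd k, 0 ≤ (nuCount V q : ℤ) * (2 ^ n * (∑ ξ : Pd n, ind S ξ * ind W (glue ξ q)) - ∑ ξ : Pd n, (nuCount S ξ : ℤ) * ind W (glue ξ q)) := by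
    intro q
    refine mul_nonneg (by exact_mod_cast Nat.zero_le _) ?_
    have h := sum_nuCount_mul_ind_glue_le hS hW q
    linarith
  -- the identity: RHS − (sectionwise bound) = Σ_q ν_V(q)·(Harris slack at q)
  have key : (∑ ξ : Pd n, (2:ℤ) ^ n * ind S ξ * ∑ q : Pd k, ind W (glue ξ q) * lamU V q) +
      (∑ q : Pd k, (nuCount V q : ℤ) * (2 ^ n * (∑ ξ : Pd n, ind S ξ * ind W (glue ξ q)) - ∑ ξ : Pd n, (nuCount S ξ : ℤ) * ind W (glue ξ q))) =
      ∑ ξ : Pd n, ∑ q : Pd k, ind W (glue ξ q) * (2 * (2:ℤ) ^ (n + k) * (ind S ξ * ind V q) - (nuCount S ξ : ℤ) * (nuCount V q : ℤ)) := by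
    have e2 : (∑ q : Pd k, (nuCount V q : ℤ) * (2 ^ n * (∑ ξ : Pd n, ind S ξ * ind W (glue ξ q)) - ∑ ξ : Pd n, (nuCount S ξ : ℤ) * ind W (glue ξ q)))
        = ∑ ξ : Pd n, ∑ q : Pd k, (nuCount V q : ℤ) * (2 ^ n * (ind S ξ * ind W (glue ξ q)) - (nuCount S ξ : ℤ) * ind W (glue ξ q)) := by
      rw [Finset.sum_comm]
      refine Finset.sum_congr rfl fun q _ => ?_
      rw [Finset.mul_sum, ← Finset.sum_sub_distrib, Finset.mul_sum]
    rw [e2, ← Finset.sum_add_distrib]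
    refine Finset.sum_congr rfl fun ξ _ => ?_
    rw [Finset.mul_sum, ← Finset.sum_add_distrib]
    refine Finset.sum_congr rfl fun q _ => ?_
    unfold lamU
    rw [pow_add]
    ring
  have hsum : (∑ ξ : Pd n, ∑ q : Pd k, ind W (glue ξ q) * ((2:ℤ) ^ n * ind S ξ * d q)) ≤
      ∑ ξ : Pd n, (2:ℤ) ^ n * ind S ξ * ∑ q : Pd k, ind W (glue ξ q) * lamU V q := Finset.sum_le_sum fun ξ _ => hsec ξ
  have hpos : 0 ≤ ∑ q : Pd k, (nuCount V q : ℤ) * (2 ^ n * (∑ ξ : Pd n, ind S ξ * ind W (glue ξ q)) - ∑ ξ : Pd n, (nuCount S ξ : ℤ) * ind W (glue ξ q)) :=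
    Finset.sum_nonneg fun q _ => hhar q
  linarith [key]

end Summit.CriticalPhenomena.PercolationContinuityZ3.Theorems.SahiGridPattern
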